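import Summits.Ventures.Crystal3D.Theorems.StickyWulffConstantGenericWallFloorShallowSeparation
import Summits.Ventures.Crystal3D.Theorems.StickyWulffConstantGenericWallFloorInverseWord
import HarnessLib

/-!
# The uniform tail of the certificate in the kernel: UNREAD steering pairs are SEPARATED
# (crux `GenericWallFloor`, stmt-Ventures-19480, line `WallLedgerG`; kernel form of ROCERT-g13 §4, 19480-p1, cf-p1 (lxxviii))

HONEST FRAMING. Part of the venture `Summits/Ventures/Crystal3D` (cell `crystal3d-full`), helper `--supports` the crux `GenericWallFloor`
(stmt-Ventures-19480) of `route-Ventures-StickyWulffConstant`, registered line `WallLedgerG`, open stub `stub_twoSlabAdhesion`.  Rung credit only;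
census-free, standard axioms; F-C1 not moved.  PURPOSE: the certificate `ResidualOneSidedCoverage (13/25)` (ROCERT-g13) covers the words of
length `|κ| ≥ 10` UNIFORMLY by a «two-steering pigeonhole»: per box of wall normals two steering families whose forced rays have pairwise
DISJOINT length-5 prefix sets, so that every word is READ to depth `≥ 5` by at most one of them; the UNREAD family is then separated.  The
step «unread ⇒ separated» was a paper theorem (ROCERT §4) resting on the tree's word calculus; this file makes it a tree theorem, so that
the tail's computational content is only the finite per-box checks (caps, steepness, flux, prefix disjointness).

* `exists_read_witness_word` — `exists_shallow_witness` (…RayAlignedDepth) with the ray data explicit and two more conclusions: the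
  shallow tips are PREFIXES of the given nodes (`d₁ ≤ |α|`, `d₂ ≤ |β|`) and THE READ: `κ`'s last `d₁` mirrors are those of grain 1's
  surviving ray prefix `α.drop (|α| − d₁)` (= `map_reflection_eq_of_image_eq`, which the original proof used only for the length count).
* `exists_read_witness` — node form: co-axial nodes at depths `(D₁, D₂)` ⇒ co-axial nodes at depths `d₁ ≤ D₁`, `d₂ ≤ D₂` on the same
  rays with `|κ| − 1 ≤ d₁ + d₂ ≤ |κ|` and `(rayWord z₁ ⟨A₁,u₁,0⟩ n₁ d₁) ≡ κ.drop (|κ| − d₁)` as mirror sequences (grain 1 READS the last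
  `d₁` letters of `κ`).
* **`chainFrames_separated_of_unread`** — if every forced ray of `(A₁, u₁)` (vertical `z₁`) reads at most `d` letters of `κ`'s end
  (its depth-`(d+1)` ray word is not `κ.drop (|κ|−(d+1))` as a mirror sequence), every forced ray of `(A₂, u₂)` (vertical `z₂`) reads at
  most `c` letters of the end of the INVERSE word `κ.reverse.map S` (…InverseWord; for every admissible lattice symmetry `S`), and
  `d + c + 2 ≤ |κ|`, then NO chain frame of `(A₁, u₁)` is co-axial with a chain frame of `(A₂, u₂)`.  Proof: a read witness gives a grain-1
  tip at depth `d₁ ≤ d`; the read witness of the FLIPPED presentation started from these tips gives depths `e₁ ≤ d₁ ≤ d`, `e₂ ≤ c` with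
  `e₁ + e₂ ≥ |κ| − 1` — contradiction.  `stackFrames_separated_of_unread`: the stack form.
* the charge-class packaging `separatedTiltAtCharge_of_unread` (tilt caps, steepness, flux floor `2c₀` ⇒ `SeparatedTiltAtCharge c₀`;
  ROCERT §4's THEOREM with `d = c = 4`, `|κ| ≥ 10`) is the sequel `…TailSeparationCharge`.
WHAT THIS IS NOT: the 612-box datum (which family is unread where) stays computational; not the stub; F-C1 not moved.
-/

noncomputable section

namespace Summit.Ventures.Crystal3D.Theorems

open Summit.Ventures.Crystal3D Finset
open Literature.MathematicalPhysics.StatisticalMechanics (fccStacking barlowStacking IsHaggSeq)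
open scoped InnerProductSpace

/-! ### The read witness -/

/-- **Read witness, word form** (`exists_shallow_witness` with explicit ray data `α`, `β` of the two co-axial frames): the shallow
co-axial tips are prefixes of the given rays (`d₁ ≤ |α|`, `d₂ ≤ |β|`, `|κ| − 1 ≤ d₁ + d₂ ≤ |κ|`) and `κ`'s last `d₁` letters have the
mirrors of grain 1's surviving prefix `α.drop (|α| − d₁)`. -/
theorem exists_read_witness_word {z₁ z₂ : EuclideanSpace ℝ (Fin 3)}
    {A₁ A₂ F₁ F₂ : EuclideanSpace ℝ (Fin 3) ≃ₗᵢ[ℝ] EuclideanSpace ℝ (Fin 3)} {u₁ u₂ : EuclideanSpace ℝ (Fin 3)}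
    {κ : List (EuclideanSpace ℝ (Fin 3))}
    (hκl : ∀ μ ∈ κ, ‖μ‖ = 1 ∧
      ∀ w ∈ fccSlots, ⟪w, μ⟫_ℝ = 0 ∨ ⟪w, μ⟫_ℝ = Real.sqrt (2 / 3) ∨ ⟪w, μ⟫_ℝ = -Real.sqrt (2 / 3))
    (hκc : List.IsChain (fun μ μ' => ⟪μ, μ'⟫_ℝ = 1 / 3 ∨ ⟪μ, μ'⟫_ℝ = -1 / 3) κ)
    (hA₂ : A₂ '' fccStacking 1 (Real.sqrt (2 / 3)) = (wordFrame A₁ κ) '' fccStacking 1 (Real.sqrt (2 / 3)))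
    {α β : List (EuclideanSpace ℝ (Fin 3))} (hF₁α : F₁ = wordFrame A₁ α)
    (hαl : ∀ μ ∈ α, ‖μ‖ = 1 ∧
      ∀ w ∈ fccSlots, ⟪w, μ⟫_ℝ = 0 ∨ ⟪w, μ⟫_ℝ = Real.sqrt (2 / 3) ∨ ⟪w, μ⟫_ℝ = -Real.sqrt (2 / 3))
    (hαc : List.IsChain (fun μ μ' => ⟪μ, μ'⟫_ℝ = 1 / 3 ∨ ⟪μ, μ'⟫_ℝ = -1 / 3) α)
    (hray₁ : ∀ d : ℕ, d ≤ α.length → ∃ G ∈ chainFrames z₁ A₁ u₁, G = wordFrame A₁ (α.drop (α.length - d)) ∧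
      (d = 0 ∧ G = A₁ ∨ ∃ n : EuclideanSpace ℝ (Fin 3), ‖n‖ = 1 ∧
        (∀ w ∈ fccSlots, ⟪A₁ w, n⟫_ℝ = 0 ∨ ⟪A₁ w, n⟫_ℝ = Real.sqrt (2 / 3) ∨ ⟪A₁ w, n⟫_ℝ = -Real.sqrt (2 / 3)) ∧
        ⟪A₁ u₁, n⟫_ℝ = Real.sqrt (2 / 3) ∧ 0 < d ∧ G = (forcedTop z₁ ⟨A₁, u₁, 0⟩ n (d - 1)).frame))
    (hF₂β : F₂ = wordFrame A₂ β)
    (hβl : ∀ μ ∈ β, ‖μ‖ = 1 ∧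
      ∀ w ∈ fccSlots, ⟪w, μ⟫_ℝ = 0 ∨ ⟪w, μ⟫_ℝ = Real.sqrt (2 / 3) ∨ ⟪w, μ⟫_ℝ = -Real.sqrt (2 / 3))
    (hβc : List.IsChain (fun μ μ' => ⟪μ, μ'⟫_ℝ = 1 / 3 ∨ ⟪μ, μ'⟫_ℝ = -1 / 3) β)
    (hray₂ : ∀ d : ℕ, d ≤ β.length → ∃ G ∈ chainFrames z₂ A₂ u₂, G = wordFrame A₂ (β.drop (β.length - d)) ∧
      (d = 0 ∧ G = A₂ ∨ ∃ n : EuclideanSpace ℝ (Fin 3), ‖n‖ = 1 ∧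
        (∀ w ∈ fccSlots, ⟪A₂ w, n⟫_ℝ = 0 ∨ ⟪A₂ w, n⟫_ℝ = Real.sqrt (2 / 3) ∨ ⟪A₂ w, n⟫_ℝ = -Real.sqrt (2 / 3)) ∧
        ⟪A₂ u₂, n⟫_ℝ = Real.sqrt (2 / 3) ∧ 0 < d ∧ G = (forcedTop z₂ ⟨A₂, u₂, 0⟩ n (d - 1)).frame))
    (hco : ∃ (L : EuclideanSpace ℝ (Fin 3) ≃ₗᵢ[ℝ] EuclideanSpace ℝ (Fin 3))
        (s₁ s₂ : EuclideanSpace ℝ (Fin 3)) (σ σ' : ℤ → ℤ), IsHaggSeq σ ∧ IsHaggSeq σ' ∧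
        F₁ '' fccStacking 1 (Real.sqrt (2 / 3)) ⊆ (fun p => L p + s₁) '' barlowStacking 1 (Real.sqrt (2 / 3)) σ ∧
        F₂ '' fccStacking 1 (Real.sqrt (2 / 3)) ⊆ (fun p => L p + s₂) '' barlowStacking 1 (Real.sqrt (2 / 3)) σ') :
    ∃ d₁ d₂ : ℕ, d₁ ≤ α.length ∧ d₂ ≤ β.length ∧ d₁ + d₂ ≤ κ.length ∧ κ.length ≤ d₁ + d₂ + 1 ∧
      (κ.drop (κ.length - d₁)).map (fun μ => (ℝ ∙ μ)ᗮ.reflection) =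
        (α.drop (α.length - d₁)).map (fun μ => (ℝ ∙ μ)ᗮ.reflection) ∧
      ∃ G₁ ∈ chainFrames z₁ A₁ u₁, ∃ G₂ ∈ chainFrames z₂ A₂ u₂,
        G₁ = wordFrame A₁ (α.drop (α.length - d₁)) ∧ G₂ = wordFrame A₂ (β.drop (β.length - d₂)) ∧
        (d₁ = 0 ∧ G₁ = A₁ ∨ ∃ n₁ : EuclideanSpace ℝ (Fin 3), ‖n₁‖ = 1 ∧
          (∀ w ∈ fccSlots, ⟪A₁ w, n₁⟫_ℝ = 0 ∨ ⟪A₁ w, n₁⟫_ℝ = Real.sqrt (2 / 3) ∨ ⟪A₁ w, n₁⟫_ℝ = -Real.sqrt (2 / 3)) ∧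
          ⟪A₁ u₁, n₁⟫_ℝ = Real.sqrt (2 / 3) ∧ 0 < d₁ ∧ G₁ = (forcedTop z₁ ⟨A₁, u₁, 0⟩ n₁ (d₁ - 1)).frame) ∧
        (d₂ = 0 ∧ G₂ = A₂ ∨ ∃ n₂ : EuclideanSpace ℝ (Fin 3), ‖n₂‖ = 1 ∧
          (∀ w ∈ fccSlots, ⟪A₂ w, n₂⟫_ℝ = 0 ∨ ⟪A₂ w, n₂⟫_ℝ = Real.sqrt (2 / 3) ∨ ⟪A₂ w, n₂⟫_ℝ = -Real.sqrt (2 / 3)) ∧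
          ⟪A₂ u₂, n₂⟫_ℝ = Real.sqrt (2 / 3) ∧ 0 < d₂ ∧ G₂ = (forcedTop z₂ ⟨A₂, u₂, 0⟩ n₂ (d₂ - 1)).frame) ∧
        ∃ (L : EuclideanSpace ℝ (Fin 3) ≃ₗᵢ[ℝ] EuclideanSpace ℝ (Fin 3))
          (s₁ s₂ : EuclideanSpace ℝ (Fin 3)) (σ σ' : ℤ → ℤ), IsHaggSeq σ ∧ IsHaggSeq σ' ∧
          G₁ '' fccStacking 1 (Real.sqrt (2 / 3)) ⊆ (fun p => L p + s₁) '' barlowStacking 1 (Real.sqrt (2 / 3)) σ ∧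
          G₂ '' fccStacking 1 (Real.sqrt (2 / 3)) ⊆ (fun p => L p + s₂) '' barlowStacking 1 (Real.sqrt (2 / 3)) σ' := by
  obtain ⟨S, γ, j, hS, hγ, hj, hγjl, hSx, himg⟩ := exists_word_of_coaxial_wordFrames hF₁α hF₂β hβl hco
  have hl : ∀ μ ∈ γ ++ j ++ α, ‖μ‖ = 1 ∧
      ∀ w ∈ fccSlots, ⟪w, μ⟫_ℝ = 0 ∨ ⟪w, μ⟫_ℝ = Real.sqrt (2 / 3) ∨ ⟪w, μ⟫_ℝ = -Real.sqrt (2 / 3) := by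
    intro μ hμ
    rcases List.mem_append.1 hμ with h | h
    · exact hγjl μ h
    · exact hαl μ h
  have hγc : List.IsChain (fun μ μ' => ⟪μ, μ'⟫_ℝ = 1 / 3 ∨ ⟪μ, μ'⟫_ℝ = -1 / 3) γ := by
    rw [hγ]; exact isChain_reverse_map S hβc
  have hjlen : j.length ≤ 1 := by
    rcases hj with rfl | ⟨m, -, -, rfl⟩ <;> simp
  have hγlen : γ.length = β.length := by rw [hγ, List.length_map, List.length_reverse]
  obtain ⟨p, q, j', hp, hq, hj', hρc, hwf, hpartial⟩ := junctions_structure A₁ γ j α hl hγc hαc hjlen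
  -- letters of the reduced form
  have hj'sub : ∀ μ ∈ j', μ ∈ j := by
    rcases hj' with rfl | rfl
    · intro μ hμ; simp at hμ
    · exact fun μ hμ => hμ
  have hρl : ∀ μ ∈ γ.take p ++ j' ++ α.drop q, ‖μ‖ = 1 ∧
      ∀ w ∈ fccSlots, ⟪w, μ⟫_ℝ = 0 ∨ ⟪w, μ⟫_ℝ = Real.sqrt (2 / 3) ∨ ⟪w, μ⟫_ℝ = -Real.sqrt (2 / 3) := by
    intro μ hμ
    rcases List.mem_append.1 hμ with h | h
    · rcases List.mem_append.1 h with h' | h'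
      · exact hl μ (by simp [List.mem_of_mem_take h'])
      · exact hl μ (by simp [hj'sub μ h'])
    · exact hl μ (by simp [List.mem_of_mem_drop h])
  -- rigidity: `κ` has the mirrors of the reduced form, in particular its length
  have himgs : (wordFrame A₁ κ : EuclideanSpace ℝ (Fin 3) → EuclideanSpace ℝ (Fin 3)) '' ↑fccSlots =
      (wordFrame A₁ (γ.take p ++ j' ++ α.drop q) : EuclideanSpace ℝ (Fin 3) → EuclideanSpace ℝ (Fin 3)) ''
        ↑fccSlots :=
    image_fccSlots_eq_of_image_fcc_eq _ _ (by rw [← hA₂, himg, hwf])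
  have hmap := map_reflection_eq_of_image_eq A₁ hκl hκc hρl hρc himgs
  have hj'len : j'.length ≤ 1 := by
    rcases hj' with rfl | rfl
    · simp
    · exact hjlen
  have hlen : κ.length = p + j'.length + (α.length - q) := by
    have h := congrArg List.length hmap
    rw [List.length_map, List.length_map, List.length_append, List.length_append, List.length_take,
      List.length_drop, min_eq_left hp] at h
    exact h
  refine ⟨α.length - q, p, Nat.sub_le _ _, by omega, by omega, by omega, ?_, ?_⟩
  · -- the read: `κ`'s last `|α| − q` mirrors are those of `α.drop q`
    have hdrop := congrArg (List.drop (p + j'.length)) hmap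
    rw [← List.map_drop, ← List.map_drop, show γ.take p ++ j' ++ α.drop q = (γ.take p ++ j') ++ α.drop q by
      rw [List.append_assoc], show p + j'.length = (γ.take p ++ j').length by
      rw [List.length_append, List.length_take, min_eq_left hp], List.drop_left] at hdrop
    rw [show κ.length - (α.length - q) = (γ.take p ++ j').length by
      rw [List.length_append, List.length_take, min_eq_left hp]; omega,
      show α.length - (α.length - q) = q by omega]
    exact hdrop
  -- the two tips
  obtain ⟨G₁, hG₁, hG₁w, hG₁d⟩ := hray₁ (α.length - q) (Nat.sub_le _ _)
  rw [show α.length - (α.length - q) = q by omega] at hG₁w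
  obtain ⟨G₂, hG₂, hG₂w, hG₂d⟩ := hray₂ p (by rw [← hγlen]; exact hp)
  refine ⟨G₁, hG₁, G₂, hG₂, by rw [show α.length - (α.length - q) = q by omega]; exact hG₁w, hG₂w, hG₁d, hG₂d, ?_⟩
  -- the lattice of the grain-2 tip, transported: `G₂·Λ₀ = (wordFrame A₁ (j' ++ α.drop q))·Λ₀`
  set δ := β.drop (β.length - p) with hδ
  have hδl : ∀ μ ∈ δ, ‖μ‖ = 1 := fun μ hμ => (hβl μ (List.mem_of_mem_drop hμ)).1
  have hδlen : (δ.map S).length = p := by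
    rw [List.length_map, hδ, List.length_drop]; omega
  have hγsplit : γ = (δ.map S).reverse ++ γ.drop p := by
    have h1 : γ = (δ.map S).reverse ++ ((β.take (β.length - p)).reverse).map S := by
      rw [hγ, ← List.map_reverse, ← List.map_append, ← List.reverse_append, List.take_append_drop]
    have h2 : γ.drop p = ((β.take (β.length - p)).reverse).map S := by
      conv_lhs => rw [h1]
      rw [← hδlen, ← List.length_reverse, List.drop_left]
    rw [h2]; exact h1
  have hG₂img : G₂ '' fccStacking 1 (Real.sqrt (2 / 3)) =
      (wordFrame A₁ (j' ++ α.drop q)) '' fccStacking 1 (Real.sqrt (2 / 3)) := by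
    rw [hG₂w, image_wordFrame_of_transport hS hSx δ hδl, ← wordFrame_append, ← hpartial]
    congr 2
    conv_lhs => rw [hγsplit]
    rw [show δ.map S ++ (((δ.map S).reverse ++ γ.drop p) ++ j ++ α) =
        ((δ.map S).reverse).reverse ++ (δ.map S).reverse ++ (γ.drop p ++ j ++ α) by
      rw [List.reverse_reverse]; simp only [List.append_assoc]]
    rw [wordFrame_reverse_cancel]
  -- equal or twin
  refine coaxial_of_image_eq_or_twin G₁ G₂ ?_
  rcases hj' with rfl | rfl
  · left; rw [hG₂img, hG₁w, List.nil_append]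
  · -- `j' = j`: empty or one junction letter
    rcases hj with rfl | ⟨m, -, -, rfl⟩
    · left; rw [hG₂img, hG₁w, List.nil_append]
    · right
      set x := F₁.symm m with hx
      obtain ⟨hx1, hxm⟩ := hl x (by simp)
      refine ⟨G₁ x, by rw [LinearIsometryEquiv.norm_map, hx1], menu_frame_of_model G₁ hxm, ?_⟩
      rw [hG₂img, ← wordFrame_singleton_eq_twinFrame G₁ hx1, hG₁w, ← wordFrame_append]

/-! ### Reads -/

/-- **A node of depth `m > 0` on a forced ray READS its word**: if the chain frame `wordFrame A ω` (`ω` reduced admissible of length `m`)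
is level `m − 1` of the forced ray through `n`, then `ω` has the mirrors of `rayWord z ⟨A, u, 0⟩ n m` (reduced-word rigidity). -/
theorem rayWord_map_eq_of_node {z : EuclideanSpace ℝ (Fin 3)} {A G : EuclideanSpace ℝ (Fin 3) ≃ₗᵢ[ℝ] EuclideanSpace ℝ (Fin 3)}
    {u n : EuclideanSpace ℝ (Fin 3)} {ω : List (EuclideanSpace ℝ (Fin 3))} {m : ℕ} (hn : ‖n‖ = 1)
    (hmenu : ∀ w ∈ fccSlots, ⟪A w, n⟫_ℝ = 0 ∨ ⟪A w, n⟫_ℝ = Real.sqrt (2 / 3) ∨ ⟪A w, n⟫_ℝ = -Real.sqrt (2 / 3))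
    (hωl : ∀ μ ∈ ω, ‖μ‖ = 1 ∧
      ∀ w ∈ fccSlots, ⟪w, μ⟫_ℝ = 0 ∨ ⟪w, μ⟫_ℝ = Real.sqrt (2 / 3) ∨ ⟪w, μ⟫_ℝ = -Real.sqrt (2 / 3))
    (hωc : List.IsChain (fun μ μ' => ⟪μ, μ'⟫_ℝ = 1 / 3 ∨ ⟪μ, μ'⟫_ℝ = -1 / 3) ω)
    (hG : G = wordFrame A ω) (hm : 0 < m) (hGd : G = (forcedTop z ⟨A, u, 0⟩ n (m - 1)).frame) :
    (rayWord z ⟨A, u, 0⟩ n m).map (fun μ => (ℝ ∙ μ)ᗮ.reflection) = ω.map (fun μ => (ℝ ∙ μ)ᗮ.reflection) := by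
  obtain ⟨k, rfl⟩ : ∃ k, m = k + 1 := ⟨m - 1, by omega⟩
  have hfr := forcedTop_frame_eq_wordFrame z ⟨A, u, 0⟩ hn hmenu k
  rw [show k + 1 - 1 = k from rfl] at hGd
  have heq : wordFrame A (rayWord z ⟨A, u, 0⟩ n (k + 1)) = wordFrame A ω := by rw [← hG, hGd, hfr]
  exact map_reflection_eq_of_image_eq A (rayWord_letters z ⟨A, u, 0⟩ hn hmenu k).1 (rayWord_isChain z ⟨A, u, 0⟩ hn hmenu k)
    hωl hωc (by rw [heq])

/-- **Reads are monotone in the depth**: a ray reading `ω` (length `m`) to depth `m` reads its last `j` letters to depth `j ≤ m`. -/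
theorem rayWord_map_eq_drop (z : EuclideanSpace ℝ (Fin 3)) (b : WalkEntry) (n : EuclideanSpace ℝ (Fin 3))
    {ω : List (EuclideanSpace ℝ (Fin 3))} {m j : ℕ} (hjm : j ≤ m)
    (h : (rayWord z b n m).map (fun μ => (ℝ ∙ μ)ᗮ.reflection) = ω.map (fun μ => (ℝ ∙ μ)ᗮ.reflection)) :
    (rayWord z b n j).map (fun μ => (ℝ ∙ μ)ᗮ.reflection) = (ω.drop (m - j)).map (fun μ => (ℝ ∙ μ)ᗮ.reflection) := by
  have hw : rayWord z b n j = (rayWord z b n m).drop (m - j) := by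
    rw [rayWord_drop z b n (by omega : m - j ≤ m), show m - (m - j) = j by omega]
  rw [hw, List.map_drop, List.map_drop, h]


/-- Dropping the same number of letters preserves equality of mirror sequences. -/
theorem map_reflection_drop_congr {l₁ l₂ : List (EuclideanSpace ℝ (Fin 3))}
    (h : l₁.map (fun μ => (ℝ ∙ μ)ᗮ.reflection) = l₂.map (fun μ => (ℝ ∙ μ)ᗮ.reflection)) (t : ℕ) :
    (l₁.drop t).map (fun μ => (ℝ ∙ μ)ᗮ.reflection) = (l₂.drop t).map (fun μ => (ℝ ∙ μ)ᗮ.reflection) := by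
  rw [List.map_drop, List.map_drop, h]

/-- Ray data of a PREFIX: the surviving word `α.drop (|α| − D)` of a depth-`D` tip inherits the ray data of `α`. -/
theorem rayData_drop {z : EuclideanSpace ℝ (Fin 3)} {A : EuclideanSpace ℝ (Fin 3) ≃ₗᵢ[ℝ] EuclideanSpace ℝ (Fin 3)}
    {u : EuclideanSpace ℝ (Fin 3)} {α : List (EuclideanSpace ℝ (Fin 3))}
    (hray : ∀ d : ℕ, d ≤ α.length → ∃ G ∈ chainFrames z A u, G = wordFrame A (α.drop (α.length - d)) ∧
      (d = 0 ∧ G = A ∨ ∃ n : EuclideanSpace ℝ (Fin 3), ‖n‖ = 1 ∧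
        (∀ w ∈ fccSlots, ⟪A w, n⟫_ℝ = 0 ∨ ⟪A w, n⟫_ℝ = Real.sqrt (2 / 3) ∨ ⟪A w, n⟫_ℝ = -Real.sqrt (2 / 3)) ∧
        ⟪A u, n⟫_ℝ = Real.sqrt (2 / 3) ∧ 0 < d ∧ G = (forcedTop z ⟨A, u, 0⟩ n (d - 1)).frame))
    {D : ℕ} (hD : D ≤ α.length) :
    ∀ d : ℕ, d ≤ (α.drop (α.length - D)).length → ∃ G ∈ chainFrames z A u,
      G = wordFrame A ((α.drop (α.length - D)).drop ((α.drop (α.length - D)).length - d)) ∧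
      (d = 0 ∧ G = A ∨ ∃ n : EuclideanSpace ℝ (Fin 3), ‖n‖ = 1 ∧
        (∀ w ∈ fccSlots, ⟪A w, n⟫_ℝ = 0 ∨ ⟪A w, n⟫_ℝ = Real.sqrt (2 / 3) ∨ ⟪A w, n⟫_ℝ = -Real.sqrt (2 / 3)) ∧
        ⟪A u, n⟫_ℝ = Real.sqrt (2 / 3) ∧ 0 < d ∧ G = (forcedTop z ⟨A, u, 0⟩ n (d - 1)).frame) := by
  intro d hd
  rw [List.length_drop] at hd ⊢
  have hd' : d ≤ α.length := by omega
  obtain ⟨G, hG, hGw, hGd⟩ := hray d hd'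
  refine ⟨G, hG, ?_, hGd⟩
  rw [hGw, List.drop_drop]
  congr 2
  omega

/-! ### Unread pairs are separated -/

/-- **UNREAD STEERING PAIRS ARE SEPARATED** (the two-steering pigeonhole step of ROCERT-g13 §4 in the kernel).  Let `A₂·Λ₀ = (wordFrame A₁ κ)·Λ₀`
with `κ` reduced admissible, `d + c + 2 ≤ |κ|`.  If every forced ray of `(A₁, u₁)` for the vertical `z₁` reads at most `d` letters of the
END of `κ` (its depth-`(d+1)` ray word is not `κ.drop (|κ| − (d+1))` as a mirror sequence) and every forced ray of `(A₂, u₂)` for `z₂`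
reads at most `c` letters of the end of the inverse word `κ.reverse.map S` (for every lattice symmetry `S` presenting `A₁·Λ₀` over `A₂`),
then NO chain frame of `(A₁, u₁)` is co-axial with a chain frame of `(A₂, u₂)`. -/
theorem chainFrames_separated_of_unread {z₁ z₂ : EuclideanSpace ℝ (Fin 3)}
    {A₁ A₂ : EuclideanSpace ℝ (Fin 3) ≃ₗᵢ[ℝ] EuclideanSpace ℝ (Fin 3)} {u₁ u₂ : EuclideanSpace ℝ (Fin 3)}
    {κ : List (EuclideanSpace ℝ (Fin 3))}
    (hκl : ∀ μ ∈ κ, ‖μ‖ = 1 ∧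
      ∀ w ∈ fccSlots, ⟪w, μ⟫_ℝ = 0 ∨ ⟪w, μ⟫_ℝ = Real.sqrt (2 / 3) ∨ ⟪w, μ⟫_ℝ = -Real.sqrt (2 / 3))
    (hκc : List.IsChain (fun μ μ' => ⟪μ, μ'⟫_ℝ = 1 / 3 ∨ ⟪μ, μ'⟫_ℝ = -1 / 3) κ)
    (hA₂ : A₂ '' fccStacking 1 (Real.sqrt (2 / 3)) = (wordFrame A₁ κ) '' fccStacking 1 (Real.sqrt (2 / 3)))
    {d c : ℕ} (hdc : d + c + 2 ≤ κ.length)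
    (hread₁ : ∀ n₁ : EuclideanSpace ℝ (Fin 3), ‖n₁‖ = 1 →
      (∀ w ∈ fccSlots, ⟪A₁ w, n₁⟫_ℝ = 0 ∨ ⟪A₁ w, n₁⟫_ℝ = Real.sqrt (2 / 3) ∨ ⟪A₁ w, n₁⟫_ℝ = -Real.sqrt (2 / 3)) →
      ⟪A₁ u₁, n₁⟫_ℝ = Real.sqrt (2 / 3) →
      (rayWord z₁ ⟨A₁, u₁, 0⟩ n₁ (d + 1)).map (fun μ => (ℝ ∙ μ)ᗮ.reflection) ≠
        (κ.drop (κ.length - (d + 1))).map (fun μ => (ℝ ∙ μ)ᗮ.reflection))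
    (hread₂ : ∀ (S : EuclideanSpace ℝ (Fin 3) ≃ₗᵢ[ℝ] EuclideanSpace ℝ (Fin 3)),
      S '' fccStacking 1 (Real.sqrt (2 / 3)) = fccStacking 1 (Real.sqrt (2 / 3)) →
      A₁ '' fccStacking 1 (Real.sqrt (2 / 3)) =
        (wordFrame A₂ (κ.reverse.map S)) '' fccStacking 1 (Real.sqrt (2 / 3)) →
      ∀ n₂ : EuclideanSpace ℝ (Fin 3), ‖n₂‖ = 1 →
        (∀ w ∈ fccSlots, ⟪A₂ w, n₂⟫_ℝ = 0 ∨ ⟪A₂ w, n₂⟫_ℝ = Real.sqrt (2 / 3) ∨ ⟪A₂ w, n₂⟫_ℝ = -Real.sqrt (2 / 3)) →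
        ⟪A₂ u₂, n₂⟫_ℝ = Real.sqrt (2 / 3) →
        (rayWord z₂ ⟨A₂, u₂, 0⟩ n₂ (c + 1)).map (fun μ => (ℝ ∙ μ)ᗮ.reflection) ≠
          ((κ.reverse.map S).drop (κ.length - (c + 1))).map (fun μ => (ℝ ∙ μ)ᗮ.reflection)) :
    ∀ F₁ ∈ chainFrames z₁ A₁ u₁, ∀ F₂ ∈ chainFrames z₂ A₂ u₂,
      ¬ ∃ (L : EuclideanSpace ℝ (Fin 3) ≃ₗᵢ[ℝ] EuclideanSpace ℝ (Fin 3))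
        (s₁ s₂ : EuclideanSpace ℝ (Fin 3)) (σ σ' : ℤ → ℤ), IsHaggSeq σ ∧ IsHaggSeq σ' ∧
        F₁ '' fccStacking 1 (Real.sqrt (2 / 3)) ⊆ (fun p => L p + s₁) '' barlowStacking 1 (Real.sqrt (2 / 3)) σ ∧
        F₂ '' fccStacking 1 (Real.sqrt (2 / 3)) ⊆ (fun p => L p + s₂) '' barlowStacking 1 (Real.sqrt (2 / 3)) σ' := by
  intro F₁ hF₁ F₂ hF₂ hco
  obtain ⟨α, hF₁α, hαl, hαc, hray₁⟩ := exists_rayData hF₁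
  obtain ⟨β, hF₂β, hβl, hβc, hray₂⟩ := exists_rayData hF₂
  -- first witness: grain 1 reads `d₁` letters of the end of `κ`, so `d₁ ≤ d`
  obtain ⟨d₁, d₂, hd₁α, hd₂β, hsum0, hsum, hrd, G₁, -, G₂, -, hG₁w, hG₂w, hG₁d, -, hco'⟩ :=
    exists_read_witness_word hκl hκc hA₂ hF₁α hαl hαc hray₁ hF₂β hβl hβc hray₂ hco
  set α' := α.drop (α.length - d₁) with hα'
  set β' := β.drop (β.length - d₂) with hβ'
  have hα'len : α'.length = d₁ := by rw [hα', List.length_drop]; omega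
  have hβ'len : β'.length = d₂ := by rw [hβ', List.length_drop]; omega
  have hα'l : ∀ μ ∈ α', ‖μ‖ = 1 ∧
      ∀ w ∈ fccSlots, ⟪w, μ⟫_ℝ = 0 ∨ ⟪w, μ⟫_ℝ = Real.sqrt (2 / 3) ∨ ⟪w, μ⟫_ℝ = -Real.sqrt (2 / 3) :=
    fun μ hμ => hαl μ (List.mem_of_mem_drop hμ)
  have hβ'l : ∀ μ ∈ β', ‖μ‖ = 1 ∧
      ∀ w ∈ fccSlots, ⟪w, μ⟫_ℝ = 0 ∨ ⟪w, μ⟫_ℝ = Real.sqrt (2 / 3) ∨ ⟪w, μ⟫_ℝ = -Real.sqrt (2 / 3) :=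
    fun μ hμ => hβl μ (List.mem_of_mem_drop hμ)
  have hα'c : List.IsChain (fun μ μ' => ⟪μ, μ'⟫_ℝ = 1 / 3 ∨ ⟪μ, μ'⟫_ℝ = -1 / 3) α' := by
    have := hαc; rw [← List.take_append_drop (α.length - d₁) α] at this
    exact (List.isChain_append.1 this).2.1
  have hβ'c : List.IsChain (fun μ μ' => ⟪μ, μ'⟫_ℝ = 1 / 3 ∨ ⟪μ, μ'⟫_ℝ = -1 / 3) β' := by
    have := hβc; rw [← List.take_append_drop (β.length - d₂) β] at this
    exact (List.isChain_append.1 this).2.1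
  have hd₁d : d₁ ≤ d := by
    by_contra hlt
    push Not at hlt
    rcases hG₁d with ⟨h0, -⟩ | ⟨n₁, hn₁, hmenu₁, hpos₁, hd₁pos, hG₁node⟩
    · omega
    · have hread := rayWord_map_eq_of_node hn₁ hmenu₁ hα'l hα'c hG₁w hd₁pos hG₁node
      have hj := rayWord_map_eq_drop z₁ ⟨A₁, u₁, 0⟩ n₁ (by omega : d + 1 ≤ d₁) hread
      refine hread₁ n₁ hn₁ hmenu₁ hpos₁ ?_
      rw [hj, ← map_reflection_drop_congr hrd (d₁ - (d + 1)), List.drop_drop]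
      congr 2
      omega
  -- the flipped presentation
  obtain ⟨S, hS, -, hA₁', hκ'l, hκ'len, hκ'c⟩ := exists_inverse_word hκl hA₂
  -- second witness, from the tips, with the grains swapped: `e₂ ≤ d₂`, `e₁ ≤ d₁ ≤ d` and grain 2 reads `e₂` letters
  obtain ⟨e₂, e₁, he₂, he₁, hsum0₂, hsum₂, hrd₂, H₂, -, H₁, -, hH₂w, -, hH₂d, -, -⟩ :=
    exists_read_witness_word (z₁ := z₂) (z₂ := z₁) hκ'l (hκ'c hκc) hA₁' hG₂w hβ'l hβ'c (rayData_drop hray₂ hd₂β) hG₁w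
      hα'l hα'c (rayData_drop hray₁ hd₁α) (coaxial_linear_symm hco')
  rw [hβ'len] at he₂ hrd₂ hH₂w
  rw [hα'len] at he₁
  rw [hκ'len] at hsum0₂ hsum₂ hrd₂
  have he₂c : e₂ ≤ c := by
    by_contra hlt
    push Not at hlt
    rcases hH₂d with ⟨h0, -⟩ | ⟨n₂, hn₂, hmenu₂, hpos₂, he₂pos, hH₂node⟩
    · omega
    · have hωl : ∀ μ ∈ β'.drop (d₂ - e₂), ‖μ‖ = 1 ∧
          ∀ w ∈ fccSlots, ⟪w, μ⟫_ℝ = 0 ∨ ⟪w, μ⟫_ℝ = Real.sqrt (2 / 3) ∨ ⟪w, μ⟫_ℝ = -Real.sqrt (2 / 3) :=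
        fun μ hμ => hβ'l μ (List.mem_of_mem_drop hμ)
      have hωc : List.IsChain (fun μ μ' => ⟪μ, μ'⟫_ℝ = 1 / 3 ∨ ⟪μ, μ'⟫_ℝ = -1 / 3) (β'.drop (d₂ - e₂)) := by
        have := hβ'c; rw [← List.take_append_drop (d₂ - e₂) β'] at this
        exact (List.isChain_append.1 this).2.1
      have hread := rayWord_map_eq_of_node hn₂ hmenu₂ hωl hωc hH₂w he₂pos hH₂node
      have hj := rayWord_map_eq_drop z₂ ⟨A₂, u₂, 0⟩ n₂ (by omega : c + 1 ≤ e₂) hread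
      refine hread₂ S hS hA₁' n₂ hn₂ hmenu₂ hpos₂ ?_
      rw [hj, ← map_reflection_drop_congr hrd₂ (e₂ - (c + 1)), List.drop_drop]
      congr 2
      omega
  omega

/-- **The stack form**: no frame of a sound well-formed `z₁`-stack over `(A₁, u₁, 0)` is co-axial with a frame of a `z₂`-stack over
`(A₂, u₂, 0)` — the separation clause of `SeparatedWideAt` / `SeparatedTiltAtCharge`. -/
theorem stackFrames_separated_of_unread {z₁ z₂ : EuclideanSpace ℝ (Fin 3)}
    {A₁ A₂ : EuclideanSpace ℝ (Fin 3) ≃ₗᵢ[ℝ] EuclideanSpace ℝ (Fin 3)} {u₁ u₂ : EuclideanSpace ℝ (Fin 3)}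
    {κ : List (EuclideanSpace ℝ (Fin 3))}
    (hκl : ∀ μ ∈ κ, ‖μ‖ = 1 ∧
      ∀ w ∈ fccSlots, ⟪w, μ⟫_ℝ = 0 ∨ ⟪w, μ⟫_ℝ = Real.sqrt (2 / 3) ∨ ⟪w, μ⟫_ℝ = -Real.sqrt (2 / 3))
    (hκc : List.IsChain (fun μ μ' => ⟪μ, μ'⟫_ℝ = 1 / 3 ∨ ⟪μ, μ'⟫_ℝ = -1 / 3) κ)
    (hA₂ : A₂ '' fccStacking 1 (Real.sqrt (2 / 3)) = (wordFrame A₁ κ) '' fccStacking 1 (Real.sqrt (2 / 3)))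
    {d c : ℕ} (hdc : d + c + 2 ≤ κ.length)
    (hread₁ : ∀ n₁ : EuclideanSpace ℝ (Fin 3), ‖n₁‖ = 1 →
      (∀ w ∈ fccSlots, ⟪A₁ w, n₁⟫_ℝ = 0 ∨ ⟪A₁ w, n₁⟫_ℝ = Real.sqrt (2 / 3) ∨ ⟪A₁ w, n₁⟫_ℝ = -Real.sqrt (2 / 3)) →
      ⟪A₁ u₁, n₁⟫_ℝ = Real.sqrt (2 / 3) →
      (rayWord z₁ ⟨A₁, u₁, 0⟩ n₁ (d + 1)).map (fun μ => (ℝ ∙ μ)ᗮ.reflection) ≠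
        (κ.drop (κ.length - (d + 1))).map (fun μ => (ℝ ∙ μ)ᗮ.reflection))
    (hread₂ : ∀ (S : EuclideanSpace ℝ (Fin 3) ≃ₗᵢ[ℝ] EuclideanSpace ℝ (Fin 3)),
      S '' fccStacking 1 (Real.sqrt (2 / 3)) = fccStacking 1 (Real.sqrt (2 / 3)) →
      A₁ '' fccStacking 1 (Real.sqrt (2 / 3)) =
        (wordFrame A₂ (κ.reverse.map S)) '' fccStacking 1 (Real.sqrt (2 / 3)) →
      ∀ n₂ : EuclideanSpace ℝ (Fin 3), ‖n₂‖ = 1 →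
        (∀ w ∈ fccSlots, ⟪A₂ w, n₂⟫_ℝ = 0 ∨ ⟪A₂ w, n₂⟫_ℝ = Real.sqrt (2 / 3) ∨ ⟪A₂ w, n₂⟫_ℝ = -Real.sqrt (2 / 3)) →
        ⟪A₂ u₂, n₂⟫_ℝ = Real.sqrt (2 / 3) →
        (rayWord z₂ ⟨A₂, u₂, 0⟩ n₂ (c + 1)).map (fun μ => (ℝ ∙ μ)ᗮ.reflection) ≠
          ((κ.reverse.map S).drop (κ.length - (c + 1))).map (fun μ => (ℝ ∙ μ)ᗮ.reflection)) :
    ∀ stk₁ : List WalkEntry, StackSound z₁ stk₁ → StackWF z₁ stk₁ → stk₁.getLast? = some ⟨A₁, u₁, 0⟩ →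
    ∀ e₁ ∈ stk₁,
    ∀ stk₂ : List WalkEntry, StackSound z₂ stk₂ → StackWF z₂ stk₂ → stk₂.getLast? = some ⟨A₂, u₂, 0⟩ →
    ∀ e₂ ∈ stk₂,
      ¬ ∃ (L : EuclideanSpace ℝ (Fin 3) ≃ₗᵢ[ℝ] EuclideanSpace ℝ (Fin 3)) (s₁ s₂ : EuclideanSpace ℝ (Fin 3))
          (σ σ' : ℤ → ℤ), IsHaggSeq σ ∧ IsHaggSeq σ' ∧
        e₁.frame '' fccStacking 1 (Real.sqrt (2 / 3)) ⊆
          (fun p => L p + s₁) '' barlowStacking 1 (Real.sqrt (2 / 3)) σ ∧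
        e₂.frame '' fccStacking 1 (Real.sqrt (2 / 3)) ⊆
          (fun p => L p + s₂) '' barlowStacking 1 (Real.sqrt (2 / 3)) σ' :=
  fun _ hS₁ hW₁ hl₁ e₁ he₁ _ hS₂ hW₂ hl₂ e₂ he₂ =>
    chainFrames_separated_of_unread hκl hκc hA₂ hdc hread₁ hread₂ e₁.frame
      (frame_mem_chainFrames_of_stack hS₁ hW₁ hl₁ e₁ he₁) e₂.frame (frame_mem_chainFrames_of_stack hS₂ hW₂ hl₂ e₂ he₂)

end Summit.Ventures.Crystal3D.Theorems

end
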